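import Summits.AtomisticToContinuum.HydrodynamicLimit.Theorems.AntiMazurCoboundariesCorrectorPressureDecayKiferGibbsReferenceSwap
import Literature.MathematicalPhysics.KineticTheory.HardSphereDLRBridge

/-!
# The free-measure sub-window bound (line `FirstLemma`, crux stmt-AtomisticToContinuum-14135)

Registered stub `c9_windowLaw_free_ge_free` (lead seat c9, Gibbs route of the tangent entropy bound
`stub_tangentEntropyBoundUniformGibbs`, glue step "shift a window into a cell"), namespace
`Summit.AtomisticToContinuum.HydrodynamicLimit.Theorems.KiferCompactification`: the free-measure analogue of the
DLR bound `c9_windowLaw_gibbs_ge_free` (`…KiferGibbsReferenceSwap.lean`).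

For the unit-diameter hard-sphere gas with activity `z ≥ 0` and Maxwellian marks (`β > 0`), let
`R_Λ = γ_Λ(· | ∅) = gibbsSpecMeasure 1 z β u Λ ∅` be the FREE finite-volume grand-canonical law of a bounded measurable
region `Λ`, and let `W ⊆ Λ` be a measurable window with collar `T = (thickening 1 W) \ W`. Then the `W`-marginal of
`R_Λ` dominates the free law ON `W` up to the void cost of the collar:

  `e^{-z vol T} · R_W(A) ≤ (R_Λ)_W(A)`  for every measurable `A`  (`c9_windowLaw_free_ge_free`).

Proof — the proof of `c9_windowLaw_gibbs_ge_free` with the DLR equation of a Gibbs state replaced by the CONSISTENCY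
of the free specification:

* `gibbsSpecMeasure_empty_eq_hsLocalSpec` — the free law is the Poisson-form specification
  `HardSphereDLR.hsLocalSpec 1 ν_z Λ ∅`, `ν_z = z · Leb ⊗ M_β(v - u) dv` (the Janossy bridge
  `HardSphereDLR.hsLocalSpec_eq_gibbsSpec` of `HardSphereDLRBridge.lean` at the empty, hence hard-core, boundary
  condition);
* `lintegral_gibbsSpec_gibbsSpecMeasure_empty` — **consistency** `∫ γ_W(B | η) R_Λ(dη) = R_Λ(B)` for `W ⊆ Λ`
  (Georgii 2011, Def. 1.23 / (1.21), free boundary condition), transported from the tree's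
  `HardSphereDLR.lintegral_hsLocalSpec_hsLocalSpec_empty` along the bridge (the free law is carried by hard-core
  configurations, on which the two specifications agree);
* `gibbsSpecMeasure_empty_compl_count_eq_zero` — `R_Λ` is carried by configurations above `Λ`;
* `ofReal_exp_neg_le_gibbsSpecMeasure_empty_void` — the void bound `R_Λ{no particle above K} ≥ e^{-z vol K}` for
  `K ⊆ Λ`: consistency in `K` and `γ_K(void | Y) ≥ 1 / e^{z vol K}` for EVERY `Y` (`one_le_gibbsWeight_void`,
  `gibbsWeight_univ_le_ofReal_exp`);
* the stub: consistency in `W` on the window event `{ω | ω_W ∈ A}`, restricted to the boundary conditions with no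
  particle above `K = T ∩ Λ` and none above `Λᶜ` — these have no particle above the collar `T`, so the specification of
  the window event IS the free one (`gibbsSpec_window_eq_free_of_void`) —, and the void bound for `K`, `vol K ≤ vol T`.

References: H.-O. Georgii, *Gibbs Measures and Phase Transitions* (2nd ed. 2011), Def. 1.23, (1.21); D. Ruelle,
*Statistical Mechanics: Rigorous Results* (1969), §1.2.1 (2.9)–(2.12), §4.2.
-/

noncomputable section

open MeasureTheory ProbabilityTheory Set Filter Topology
open scoped ENNReal NNReal

namespace Summit.AtomisticToContinuum.HydrodynamicLimit.Theorems.KiferCompactification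

open Literature.MathematicalPhysics.KineticTheory (V3)
open Literature.MathematicalPhysics.KineticTheory.HardSphereDLR (gibbsSpecMeasure gibbsSpecMeasure_apply
  mem_superposeIn_iff hsLocalSpec hsLocalSpec_eq_gibbsSpec hsLocalSpec_ae_isHardCore
  lintegral_hsLocalSpec_hsLocalSpec_empty smul_prod_singleton isProbabilityMeasure_withDensity_maxwellianBeta
  sigmaFinite_maxwellPhaseMeasure count_eq_zero_iff')
open Literature.MathematicalPhysics.KineticTheory.PointProcess (windowLaw windowRestrict measurable_windowRestrict)
open Literature.Analysis.FluidPDE (IsHardCore isHardCore_empty HardCoreIn superposeIn gibbsWeight gibbsSpec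
  maxwellPhaseMeasure)
open Literature.Analysis.FunctionSpaces (PointConfig maxwellianBeta)

/-! ## The free law in Poisson form; consistency of the free specification -/

/-- **The free law is the Poisson-form specification with empty boundary condition**:
`γ_Λ(· | ∅) = hsLocalSpec ε ν_z Λ ∅` as measures, `ν_z = z · Leb ⊗ M_β(v - u) dv`, for a bounded measurable `Λ`
(the Janossy bridge `hsLocalSpec_eq_gibbsSpec`; the empty configuration is hard core). -/
theorem gibbsSpecMeasure_empty_eq_hsLocalSpec {ε z β : ℝ} (hz : 0 ≤ z) (hβ : 0 < β) (u : V3) {Λ : Set V3}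
    (hΛ : MeasurableSet Λ) (hΛb : Bornology.IsBounded Λ) :
    gibbsSpecMeasure ε z β u Λ ∅ = hsLocalSpec ε ((Real.toNNReal z) • ((volume : Measure V3).prod
      ((volume : Measure V3).withDensity fun v => ENNReal.ofReal (maxwellianBeta β (v - u))))) Λ ∅ :=
  Measure.ext fun A hA => by
    rw [gibbsSpecMeasure_apply ε z β u hΛ ∅ hA, hsLocalSpec_eq_gibbsSpec u hz hβ hΛ hΛb (isHardCore_empty ε) hA]

/-- **Consistency of the free finite-volume laws** (Georgii's `γ_Λ γ_W = γ_Λ` for `W ⊆ Λ`, free boundary condition),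
in the series vocabulary: for measurable `W ⊆ Λ`, `Λ` bounded, and a measurable event `B`,
`∫ γ_W(B | η) γ_Λ(dη | ∅) = γ_Λ(B | ∅)`. Transport of `lintegral_hsLocalSpec_hsLocalSpec_empty` along the bridge
`hsLocalSpec_eq_gibbsSpec`: the free law is carried by hard-core configurations, on which the two specifications of
`W` agree. -/
theorem lintegral_gibbsSpec_gibbsSpecMeasure_empty {ε z β : ℝ} (hz : 0 ≤ z) (hβ : 0 < β) (u : V3) {Λ W : Set V3}
    (hΛ : MeasurableSet Λ) (hΛb : Bornology.IsBounded Λ) (hW : MeasurableSet W) (hWΛ : W ⊆ Λ)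
    {B : Set (PointConfig (V3 × V3))} (hB : MeasurableSet B) :
    ∫⁻ η, gibbsSpec ε z β u W η B ∂(gibbsSpecMeasure ε z β u Λ ∅) = gibbsSpecMeasure ε z β u Λ ∅ B := by
  haveI := isProbabilityMeasure_withDensity_maxwellianBeta (d := Fin 3) hβ u
  set ν : Measure (V3 × V3) := (Real.toNNReal z) • ((volume : Measure V3).prod
    ((volume : Measure V3).withDensity fun v => ENNReal.ofReal (maxwellianBeta β (v - u)))) with hν
  haveI : IsLocallyFiniteMeasure ν := by rw [hν]; infer_instance
  have h0 : ∀ x, ν {x} = 0 := smul_prod_singleton z _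
  rw [gibbsSpecMeasure_empty_eq_hsLocalSpec hz hβ u hΛ hΛb, ← hν]
  calc ∫⁻ η, gibbsSpec ε z β u W η B ∂(hsLocalSpec ε ν Λ ∅)
      = ∫⁻ η, hsLocalSpec ε ν W η B ∂(hsLocalSpec ε ν Λ ∅) :=
        lintegral_congr_ae ((hsLocalSpec_ae_isHardCore ε ν Λ ∅).mono fun η hη =>
          (hsLocalSpec_eq_gibbsSpec u hz hβ hW (hΛb.subset hWΛ) hη hB).symm)
    _ = hsLocalSpec ε ν Λ ∅ B := lintegral_hsLocalSpec_hsLocalSpec_empty ν h0 hW hΛ hWΛ hB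

/-- **The free law is carried by configurations above `Λ`**: `γ_Λ({X | N_{Λᶜ × ℝ³}(X) = 0}ᶜ | ∅) = 0` — the
superposition with the empty boundary condition consists of the thrown points with position in `Λ`, so no term of the
weight charges the complement. -/
theorem gibbsSpecMeasure_empty_compl_count_eq_zero (ε z β : ℝ) (u : V3) {Λ : Set V3} (hΛ : MeasurableSet Λ) :
    gibbsSpecMeasure ε z β u Λ ∅ {X : PointConfig (V3 × V3) | X.count (Prod.fst ⁻¹' Λᶜ) = 0}ᶜ = 0 := by
  have hCm : MeasurableSet {X : PointConfig (V3 × V3) | X.count (Prod.fst ⁻¹' Λᶜ) = 0} :=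
    measurableSet_count_eq_zero (hΛ.compl.preimage measurable_fst)
  have hzero : gibbsWeight ε z β u Λ ∅ {X : PointConfig (V3 × V3) | X.count (Prod.fst ⁻¹' Λᶜ) = 0}ᶜ = 0 := by
    haveI := sigmaFinite_maxwellPhaseMeasure β u Λ
    unfold Literature.Analysis.FluidPDE.gibbsWeight
    refine ENNReal.tsum_eq_zero.2 fun k => ?_
    have hind : ∀ x : Fin k → V3 × V3, ({X : PointConfig (V3 × V3) | X.count (Prod.fst ⁻¹' Λᶜ) = 0}ᶜ ∩
        {X | HardCoreIn ε Λ X}).indicator (1 : PointConfig (V3 × V3) → ℝ≥0∞) (superposeIn Λ x ∅) = 0 := fun x => by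
      refine indicator_of_notMem (fun h => h.1 ?_) _
      rw [mem_setOf_eq, count_eq_zero_iff']
      intro p hp hpΛ
      rcases (mem_superposeIn_iff Λ x ∅ p).1 hp with ⟨-, hp1⟩ | ⟨hp0, -⟩
      · exact hpΛ hp1
      · exact Literature.MathematicalPhysics.KineticTheory.HardSphereDLR.notMem_empty' p hp0
    simp_rw [hind]
    rw [lintegral_zero, mul_zero]
  rw [gibbsSpecMeasure_apply ε z β u hΛ ∅ hCm.compl, Literature.Analysis.FluidPDE.gibbsSpec, hzero, ENNReal.zero_div]

/-- **Void probabilities of the free law**: for a measurable `K ⊆ Λ` (`Λ` bounded measurable, `z ≥ 0`, `β > 0`),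
`γ_Λ({no particle above K} | ∅) ≥ e^{-z vol K}` — consistency in `K` with `γ_K(void | Y) ≥ 1 / e^{z vol K}` for EVERY
boundary condition `Y` (`one_le_gibbsWeight_void`, `gibbsWeight_univ_le_ofReal_exp`). -/
theorem ofReal_exp_neg_le_gibbsSpecMeasure_empty_void {z β : ℝ} {u : V3} (hz : 0 ≤ z) (hβ : 0 < β) {Λ K : Set V3}
    (hΛ : MeasurableSet Λ) (hΛb : Bornology.IsBounded Λ) (hK : MeasurableSet K) (hKΛ : K ⊆ Λ) :
    ENNReal.ofReal (Real.exp (-(z * (volume K).toReal))) ≤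
      gibbsSpecMeasure 1 z β u Λ ∅ {X | X.count (Prod.fst ⁻¹' K) = 0} := by
  haveI := isProbabilityMeasure_gibbsSpecMeasure_empty hz hβ u hΛ hΛb.measure_lt_top.ne
  have hKv : volume K ≠ ∞ := (hΛb.subset hKΛ).measure_lt_top.ne
  have hVm : MeasurableSet {X : PointConfig (V3 × V3) | X.count (Prod.fst ⁻¹' K) = 0} :=
    measurableSet_count_eq_zero (hK.preimage measurable_fst)
  rw [← lintegral_gibbsSpec_gibbsSpecMeasure_empty (ε := 1) hz hβ u hΛ hΛb hK hKΛ hVm]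
  calc ENNReal.ofReal (Real.exp (-(z * (volume K).toReal)))
      = ∫⁻ _, ENNReal.ofReal (Real.exp (-(z * (volume K).toReal))) ∂(gibbsSpecMeasure 1 z β u Λ ∅) := by
        rw [lintegral_const, measure_univ, mul_one]
    _ ≤ ∫⁻ Y, gibbsSpec 1 z β u K Y {X | X.count (Prod.fst ⁻¹' K) = 0} ∂(gibbsSpecMeasure 1 z β u Λ ∅) :=
        lintegral_mono fun Y => by
          unfold Literature.Analysis.FluidPDE.gibbsSpec
          calc ENNReal.ofReal (Real.exp (-(z * (volume K).toReal)))
              = (ENNReal.ofReal (Real.exp (z * (volume K).toReal)))⁻¹ := by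
                rw [Real.exp_neg, ENNReal.ofReal_inv_of_pos (Real.exp_pos _)]
            _ = 1 / ENNReal.ofReal (Real.exp (z * (volume K).toReal)) := (one_div _).symm
            _ ≤ gibbsWeight 1 z β u K Y {X | X.count (Prod.fst ⁻¹' K) = 0} / gibbsWeight 1 z β u K Y univ :=
                ENNReal.div_le_div (one_le_gibbsWeight_void 1 z β u K Y)
                  (gibbsWeight_univ_le_ofReal_exp 1 hz hβ u hK hKv Y)

/-! ## The registered stub -/

/-- Registered stub `c9_windowLaw_free_ge_free` (line `FirstLemma`): **the `W`-marginal of the free law of `Λ ⊇ W`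
dominates the free law of `W` up to the void cost of the collar**,
`e^{-z vol((thickening 1 W) \ W)} γ_W(A | ∅) ≤ (γ_Λ(· | ∅))_W(A)`. Consistency of the free specification in `W` on the
window event `{ω | ω_W ∈ A}`, restricted to the boundary conditions with no particle above `K = collar ∩ Λ` and none
above `Λᶜ` (a full-measure event) — there the specification of the window event is the free one,
`gibbsSpec_window_eq_free_of_void` —, and the void bound `ofReal_exp_neg_le_gibbsSpecMeasure_empty_void` for `K ⊆ Λ`,
`vol K ≤ vol(collar)`. -/
theorem c9_windowLaw_free_ge_free {z β : ℝ} {u : V3} (hz : 0 ≤ z) (hβ : 0 < β) {Λ W : Set V3} (hΛ : MeasurableSet Λ)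
    (hΛb : Bornology.IsBounded Λ) (hW : MeasurableSet W) (hWΛ : W ⊆ Λ) {A : Set (PointConfig (V3 × V3))}
    (hA : MeasurableSet A) :
    ENNReal.ofReal (Real.exp (-(z * (volume (Metric.thickening 1 W \ W)).toReal))) * gibbsSpecMeasure 1 z β u W ∅ A ≤
      windowLaw W (gibbsSpecMeasure 1 z β u Λ ∅) A := by
  have hTm : MeasurableSet (Metric.thickening 1 W \ W) := Metric.isOpen_thickening.measurableSet.diff hW
  have hTb : Bornology.IsBounded (Metric.thickening 1 W \ W) :=
    (hΛb.subset hWΛ).thickening.subset fun _ hx => hx.1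
  have hKm : MeasurableSet (Metric.thickening 1 W \ W ∩ Λ) := hTm.inter hΛ
  -- the good boundary conditions: no particle above `K = collar ∩ Λ`, none above `Λᶜ`
  set V : Set (PointConfig (V3 × V3)) := {X | X.count (Prod.fst ⁻¹' (Metric.thickening 1 W \ W ∩ Λ)) = 0} with hV
  set C : Set (PointConfig (V3 × V3)) := {X | X.count (Prod.fst ⁻¹' Λᶜ) = 0} with hC
  have hVm : MeasurableSet V := measurableSet_count_eq_zero (hKm.preimage measurable_fst)
  have hCm : MeasurableSet C := measurableSet_count_eq_zero (hΛ.compl.preimage measurable_fst)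
  have hBm : MeasurableSet (windowRestrict W ⁻¹' A) := measurable_windowRestrict hW hA
  have hvoid : ∀ Y ∈ V ∩ C, Y.count (Prod.fst ⁻¹' (Metric.thickening 1 W \ W)) = 0 := by
    rintro Y ⟨hYV, hYC⟩
    rw [hV, mem_setOf_eq, count_eq_zero_iff'] at hYV
    rw [hC, mem_setOf_eq, count_eq_zero_iff'] at hYC
    rw [count_eq_zero_iff']
    intro p hp hpT
    by_cases hpΛ : p.1 ∈ Λ
    · exact hYV p hp ⟨hpT, hpΛ⟩
    · exact hYC p hp hpΛ
  have hvoidK : ENNReal.ofReal (Real.exp (-(z * (volume (Metric.thickening 1 W \ W)).toReal))) ≤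
      gibbsSpecMeasure 1 z β u Λ ∅ V :=
    calc ENNReal.ofReal (Real.exp (-(z * (volume (Metric.thickening 1 W \ W)).toReal)))
        ≤ ENNReal.ofReal (Real.exp (-(z * (volume (Metric.thickening 1 W \ W ∩ Λ)).toReal))) :=
          ENNReal.ofReal_le_ofReal (Real.exp_le_exp.2 (neg_le_neg (mul_le_mul_of_nonneg_left
            (ENNReal.toReal_mono hTb.measure_lt_top.ne (measure_mono inter_subset_left)) hz)))
      _ ≤ gibbsSpecMeasure 1 z β u Λ ∅ V :=
          ofReal_exp_neg_le_gibbsSpecMeasure_empty_void hz hβ hΛ hΛb hKm inter_subset_right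
  rw [Literature.MathematicalPhysics.KineticTheory.PointProcess.windowLaw,
    Measure.map_apply (measurable_windowRestrict hW) hA,
    ← lintegral_gibbsSpec_gibbsSpecMeasure_empty (ε := 1) hz hβ u hΛ hΛb hW hWΛ hBm]
  calc ENNReal.ofReal (Real.exp (-(z * (volume (Metric.thickening 1 W \ W)).toReal))) * gibbsSpecMeasure 1 z β u W ∅ A
      ≤ gibbsSpecMeasure 1 z β u Λ ∅ V * gibbsSpecMeasure 1 z β u W ∅ A := mul_le_mul' hvoidK le_rfl
    _ = gibbsSpecMeasure 1 z β u W ∅ A * gibbsSpecMeasure 1 z β u Λ ∅ (V ∩ C) := by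
        rw [mul_comm, measure_inter_conull (gibbsSpecMeasure_empty_compl_count_eq_zero 1 z β u hΛ)]
    _ = ∫⁻ Y, (V ∩ C).indicator (fun _ => gibbsSpecMeasure 1 z β u W ∅ A) Y ∂(gibbsSpecMeasure 1 z β u Λ ∅) :=
        (lintegral_indicator_const (hVm.inter hCm) _).symm
    _ ≤ ∫⁻ Y, gibbsSpec 1 z β u W Y (windowRestrict W ⁻¹' A) ∂(gibbsSpecMeasure 1 z β u Λ ∅) :=
        lintegral_mono fun Y => by
          by_cases hY : Y ∈ V ∩ C
          · rw [indicator_of_mem hY, gibbsSpec_window_eq_free_of_void 1 z β u hW (hvoid Y hY) hA]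
          · rw [indicator_of_notMem hY]
            exact zero_le

end Summit.AtomisticToContinuum.HydrodynamicLimit.Theorems.KiferCompactification

end
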